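import Summits.ResolutionOfSingularities.ResolutionOfSingularities.Theorems.EquisingularLiftEquisingularLiftNatLargeCharSpreadCentres
import Literature.AlgebraicGeometry.Limits.GenericFibreSpread
import Mathlib.Topology.Constructible
import HarnessLib

/-!
# EL♮(3) / EL♮(n), RUNG LC «large characteristic» — brick (B3′)(f3), SPREAD FORM: «the centre does not swallow the running transform» spreads from the
# generic fibre to EVERY fibre over every base `A → B` inverting some `a ≠ 0` (Chevalley — no dimension theory)

leafhand-res-equisingularlift-3 g0 (prover, 2026-08-31; one-generation line-first hand on stmt-ResolutionOfSingularities-20148 / -20038 /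
-15660, cell `pub/decomp-res`).  Crux `EquisingularLiftNatThree` (`stmt-…-20148`; uniform in `n`, so also `stmt-…-20038`), line W4.5(b), RUNG LC
(idea-2 g32 `Cruxes/EquisingularLiftNatThree/LARGE-CHAR-RUNG-idea2.md` v1.6 §(B3′) (f3), priced there «by fibre dimension»).  By
✓ `image_support_subset_not_isGenericPoint_of_inv` (…NatLargeCharPositionToken) the position token of ✓ `DescTransformOK` on a fibre costs exactly
«`¬ supp 𝓣_k ⊆ supp C_k`» (the centre fibre does not swallow the running-transform fibre).  This is a NON-EMPTINESS statement for the fibres of the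
`A`-scheme `V(𝓣) ∖ V(C)` — and non-emptiness of fibres spreads from the generic fibre over a basic open by CHEVALLEY (✓
`Literature.AlgebraicGeometry.Limits.exists_basicOpen_subset_image`: a constructible set whose image contains the generic point of `Spec A` has image
containing some `D(b)`, `b ≠ 0`).  No dimension theory is needed.  DEF-FREE:

* ★ `exists_forall_not_support_comap_subset` — for `q : X → Spec A` of finite type over a Noetherian domain with generic fibre `j_K` and ideal sheaves
  `𝓣`, `C` with `¬ supp j_K^*𝓣 ⊆ supp j_K^*C`: `∃ a ≠ 0` such that for every `A`-algebra `B ∋ a⁻¹`, every cartesian `X_B = X ×_A Spec B`, every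
  field-valued point `Spec k → Spec B` and fibre square `X_k = X_B ×_B Spec k`: `¬ supp (j^*ι_B^*𝓣) ⊆ supp (j^*ι_B^*C)` (a point of `supp 𝓣 ∖ supp C` over
  the image of `Spec k → Spec A`, which lies in `D(a)`, lifted to the fibre product — Mathlib `Scheme.Pullback.exists_preimage_pullback`).

USE: the per-stage input of the position token in the (B5) recursion (✓ `CentreSeq.exists_forall_descTransformOK_comap`, …NatLargeCharSpreadFibreWord, whose
position target was emptied pending exactly this).  EL♮(3) NOT proved; EL♮ NOT proved; resolution of singularities in positive characteristic NOT proved;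
nothing of [Hironaka2017] (a candidate under adjudication) is asserted or used.  [OURS · Chevalley bookkeeping over tree lemmas · standard axioms · DEF-FREE ·
`--supports stmt-ResolutionOfSingularities-20148 --as helper`, counted 0 · AI-written, weaker than expert review.]
[cite: Grothendieck1966, EGA IV₃ Thm. 9.5.1 (Chevalley spreading)] (method; index only)
-/

set_option linter.dupNamespace false -- mandated namespace `Summit.<Summit>.<Problem>` of this single-conjunct summit

noncomputable section

open CategoryTheory CategoryTheory.Limits AlgebraicGeometry TopologicalSpace Topology PrimeSpectrum
open Literature.AlgebraicGeometry.Resolution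
open AlgebraicGeometry.Scheme.IdealSheafData

namespace Summit.ResolutionOfSingularities.ResolutionOfSingularities.Cruxes.EquisingularLiftNat.Sections

section NoSwallow

variable {A : Type} [CommRing A] [IsDomain A] [IsNoetherianRing A] (K : Type) [Field K] [Algebra A K] [IsFractionRing A K]
  {X XK : Scheme.{0}} (q : X ⟶ Spec (.of A)) [LocallyOfFiniteType q] [QuasiCompact q]
  {jK : XK ⟶ X} {qK : XK ⟶ Spec (.of K)} (HK : IsPullback jK qK q (specOfAlgebra A K))

include HK in
/-- ★ **«The centre does not swallow the running transform» spreads from the generic fibre to every fibre over some `D(a)`** (Chevalley): see the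
module docstring. [cite: Grothendieck1966, EGA IV₃ Thm. 9.5.1] [OURS · L1 W4.5b · RUNG LC (B3′)(f3) spread form; EL♮(3) NOT proved] -/
theorem exists_forall_not_support_comap_subset (T C : X.IdealSheafData)
    (hns : ¬ (((T.comap jK).support : Set XK)) ⊆ ((C.comap jK).support : Set XK)) :
    ∃ a : A, a ≠ 0 ∧ ∀ (B : Type) [CommRing B] [Algebra A B], IsUnit (algebraMap A B a) →
      ∀ {XB : Scheme.{0}} (ιB : XB ⟶ X) (qB : XB ⟶ Spec (.of B)), IsPullback ιB qB q (specOfAlgebra A B) →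
        ∀ (k : Type) [Field k] [Algebra B k] {Xk : Scheme.{0}} (j : Xk ⟶ XB) (tk : Xk ⟶ Spec (.of k)),
          IsPullback j tk qB (specOfAlgebra B k) →
          ¬ ((((T.comap ιB).comap j).support : Set Xk)) ⊆ ((((C.comap ιB).comap j).support : Set Xk)) := by
  haveI : IsLocallyNoetherian X := LocallyOfFiniteType.isLocallyNoetherian q
  haveI : CompactSpace X := QuasiCompact.compactSpace_of_compactSpace q
  haveI : IsNoetherian X := {}
  -- the constructible set `Z = supp 𝓣 ∖ supp C` and its generic fibre
  set Z : Set X := ((T.support : Set X)) \ ((C.support : Set X)) with hZ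
  have hTc : IsConstructible ((T.support : Set X)) := by
    have h := ((NoetherianSpace.isCompact ((T.support : Set X))ᶜ).isConstructible T.support.isClosed.isOpen_compl).compl
    rwa [compl_compl] at h
  have hCc : IsConstructible ((C.support : Set X)) := by
    have h := ((NoetherianSpace.isCompact ((C.support : Set X))ᶜ).isConstructible C.support.isClosed.isOpen_compl).compl
    rwa [compl_compl] at h
  have hZc : IsConstructible Z := hTc.sdiff hCc
  obtain ⟨xK, hxT, hxC⟩ := Set.not_subset.mp hns
  have h0 : (⊥ : PrimeSpectrum A) ∈ q '' Z := by
    refine ⟨jK xK, ⟨?_, ?_⟩, ?_⟩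
    · have h : xK ∈ (((T.comap jK).support : Set XK)) := hxT
      rw [support_comap] at h; exact h
    · intro h; apply hxC
      show xK ∈ (((C.comap jK).support : Set XK))
      rw [support_comap]; exact h
    · rw [← Scheme.Hom.comp_apply, HK.w, Scheme.Hom.comp_apply]
      exact specMap_fractionRing_apply K (qK xK)
  obtain ⟨a, ha, hsub⟩ := Literature.AlgebraicGeometry.Limits.exists_basicOpen_subset_image q hZc h0
  refine ⟨a, ha, fun B _ _ hunit XB ιB qB HX k _ _ Xk j tk HXk hsw => ?_⟩
  -- the image of the point of `Spec k` in `Spec A` lies in `D(a)`, hence under a point `x ∈ Z`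
  let y : Spec (.of k) := ⟨⊥, Ideal.isPrime_bot⟩
  have hy : (specOfAlgebra B k ≫ specOfAlgebra A B) y ∈ (basicOpen a : Set (PrimeSpectrum A)) := by
    rw [Scheme.Hom.comp_apply]
    exact specMap_mem_basicOpen_of_isUnit B hunit _
  obtain ⟨x, hxZ, hx⟩ := hsub hy
  -- a point of the fibre `X_k` over `(x, y)`
  have Hbig : IsPullback (j ≫ ιB) tk q (specOfAlgebra B k ≫ specOfAlgebra A B) := HXk.paste_horiz HX
  obtain ⟨z, hz1, -⟩ := Scheme.Pullback.exists_preimage_pullback (f := q) (g := specOfAlgebra B k ≫ specOfAlgebra A B) x y hx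
  set w : Xk := Hbig.isoPullback.inv z with hw
  have hwx : (j ≫ ιB) w = x := by
    rw [hw, ← Scheme.Hom.comp_apply, IsPullback.isoPullback_inv_fst]; exact hz1
  -- it lies in `supp j^*ι_B^*𝓣` but not in `supp j^*ι_B^*C`
  apply hxZ.2
  have hwT : w ∈ ((((T.comap ιB).comap j).support : Set Xk)) := by
    rw [← Scheme.IdealSheafData.comap_comp, support_comap]
    show (j ≫ ιB) w ∈ (T.support : Set X)
    rw [hwx]; exact hxZ.1
  have hwC := hsw hwT
  rw [← Scheme.IdealSheafData.comap_comp, support_comap] at hwC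
  have hwC' : (j ≫ ιB) w ∈ (C.support : Set X) := hwC
  rwa [hwx] at hwC'

end NoSwallow

end Summit.ResolutionOfSingularities.ResolutionOfSingularities.Cruxes.EquisingularLiftNat.Sections

end
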